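import Summits.QuantumFields.YangMills.Theorems.BalabanUVNodesN13U1StepRRatioRowAtRecord13CoPH

/-!
# BalabanUVNodes ∕ N13 — AT THE DENSITY LEVEL THE 𝐓-STEP OF THE (2.18) EXPANSION OF RECORD IS THE KERNEL TRANSPORT: `𝐓ρ_k = T_k(ρ_k)` POINTWISE AT EVERY LEVEL (the history sum
# COLLAPSES under K0b's pointwise unity law), hence at a live-selector parameter `ρ_{k+1} ≤ T_k(ρ_k)` and the SHARP sup road `ρ_k ≤ e^{−E(P)}·Π_{j<k} D_j` — no history count —
# from everywhere marginal-density bounds; LOCATED: still valueless for (2.50), whose content is the fibre AVERAGE (Track A, DAG node N13 = [B16]; cluster K1 — K1⁷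
# `StabilityBAtRecordR13SepCoPH` = stmt-QuantumFields-20542, helper; seat `pub-ymgap-dag-n13-w3` g3, companion of p607601 ∕ p609235 ∕ p610463; 2026-08-28; count-neutral)

HONEST FRAMING.  Count-neutral kernel BOOKKEEPING (finite resummation + Bochner linearity on the probability averaging kernel); nothing of Bałaban's is asserted.  K0b proved the LEVEL-1
identity `𝐓ρ₀ = T₀(ρ₀)` pointwise (`Node00.Record12ResidualsSlots.trhoOfRecord9_zero_eq_transport`, from the POINTWISE resummation law `Σ_{s′ : init s′ = s} χ_{k+1}(s′)(V′)·w(s′)(U,V′) = 1`,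
`sum_chi_mul_wOfRecord_eq_one`, valid at EVERY `(U, V′)`).  THIS FILE types the identity AT EVERY LEVEL `k`, under the one row that makes the level-`k` fibre integrals meaningful at every
coarse field — the history terms `χ_k(s)·slot_k(s)` are measurable and bounded (DISPLAYED; measurability is K0c's theorem under (H-U), boundedness is what any everywhere road carries):
(§1, generic over def-T's weights `wOfRecord A₁ ζ` with the two ζ-laws) ★ `Σ_{s′ : init s′ = s} χ_{k+1}(s′)(V′)·slotT_{k+1}(s′)(V′) = T_k(χ_k(s)·slot_k(s))(V′)` for every old history `s` and
EVERY `V′` — the sum over the new pairs `(Ω_{k+1}, Λ_{k+1})` COLLAPSES under the transport — and ★★ `𝐓ρ_k(V′) = T_k(ρ_k)(V′)`: the 𝐓-stepped density of record IS def-T's one-step kernel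
transport of the density of record ((2.18)'s bookkeeping commutes with (3.1)); (§2, at K1⁷'s record with `Provisos₁₃CoPH`) the same at the ₁₃ plugs, and AT A LIVE-SELECTOR PARAMETER
(dag-n13-w1 g4 p607786: `ρ_{k+1} ≤ 𝐓ρ_k`) ★★ `ρ_{k+1}(V′) ≤ T_k(ρ_k)(V′)` at every field, whence — with p607601's domination `T_k f ≤ sup f · avgDensity_k` — ★★★ THE SHARP SUP ROAD
`ρ_k(V) ≤ e^{−E(P)} · Π_{j<k} D_j` at EVERY field from everywhere bounds `avgDensity_j ≤ D_j` on the marginal-density VERSIONS (dag-n13-w1 g4 §5's located object) and the measurability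
row: NO history count (it sharpens dag-n13-w1 g4's CLAIM-4 road `|Seq_k|·Π D_j·S₀` and supersedes this seat's INTENT-4 count `exp(2Σ|I_j|)`, both collapsed by unity).
LOCATED READING (numbers): the sharp sup road's exponent is `−E(P) + Σ_{j<k} log D_j` with `E(P) = Σ_{j<K} e_j`, `e_j = log g_j·dim SU(N)·tstarCount_j + log σ₀·tstarCount_j −
log z_j·(L⁴−1)|T₁^{(j+1)}| + Efl_j` (def-R `EOfRecord = Σ eStepOfRecord`, [III] Thm 1 p.262 ∕ (1.15)) — EXTENSIVE AT EVERY SCALE (`tstarCount_j ≈ L^{4(k−j)}|T₁^{(k)}|`), against (2.50)'s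
`E₊|T₁^{(k)}|` «independent of η»: print cancels the `e_j` step by step INSIDE the fibre integral (the Gaussian normalisations of (3.10)–(3.25), the `E^{(j)}` ∕ `E_k` terms of (2.23), the bound
(2.49)); `T_k(ρ_k) ≤ sup ρ_k · avgDensity_k` forgets the fibre AVERAGE.  So even the sharp sup road is a theorem WITHOUT value for (2.50): at a live selector the (U1) leaf IS an everywhere
bound on the transported density `T_k(ρ_k)` finer than `sup ρ_k` — the fluctuation integral itself ([III] §3), in a FIELD-DEPENDENT currency (p607601 §2).  (U1) NOT proved; Cor. 3 NOT proved;
N13 NOT discharged; K0⁷ ∕ K1⁷ NOT closed; counts unmoved (discharged 5∕27 · Track A 5∕28).  ONE finite four-torus programme at fixed `ε = L^{−K}`; R4 closes the conditional finite-𝕋⁴ rung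
`BalabanLadder.UV` only — the Yang–Mills mass gap (Clay) is NOT proved by any of this; nothing continuum ∕ ℝ⁴ ∕ OS.  No `sorry`, `def`, `instance`, `notation`.

Sources: [Balaban1988Convergent] (1.15) p.249, (2.18) p.257, (2.23) p.258, Thm 1 p.262, (2.49) + Cor. 3 (2.50) p.264, (3.1) p.264, §3 p.267, (3.24)–(3.25) p.270; [Balaban1989LargeFieldI]
(0.2)–(0.3) p.176, p.177 (i)–(ii); [Balaban1989LargeFieldII] (0.1) pp.355–356.
-/

noncomputable section

open MeasureTheory
open scoped BigOperators

namespace Summit.QuantumFields.YangMills.BalabanUVNodes.N13TStepDensityIsTransportAtRecord13CoPH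

open Literature.MathematicalPhysics.QuantumFieldTheory.Balaban1983to89
open T4Continuum Node00 B14.Eq218Concrete
open T4AveragingDisintegration (transportK kernelTransport avgKernel avgDensity)
open Summit.QuantumFields.YangMills.BalabanUVNodes.N13U1StepMajorantTowerAtRecord13CoPH (abs_transportOfRecord_le transportOfRecord_const_mul)
open Summit.QuantumFields.YangMills.BalabanUVNodes.N13UVRowRFreeAtLiveSelectorRecord13
  (densOfRecord₁₃_succ_le_tdens_of_liveSel wOfRecord₉_nonneg)

/-! ## §1. GENERIC over def-T's step weights `wOfRecord A₁ ζ`: the new-pair sum collapses under the transport; `𝐓ρ_k = T_k(ρ_k)` -/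

section Generic

variable (F : T4Family) (N : ℕ) [NeZero N] (ν : Stage7Numerics) (τ : TowerNumerics) (A₁ : ℝ)

open Classical in
/-- **★ THE NEW-PAIR SUM COLLAPSES UNDER THE TRANSPORT**: for def-T's step weights `w = wOfRecord A₁ ζ` with the two ζ-laws and measurable `U`-sections, and a level-`k` history `s` whose term
`χ_k(s)·slot_k(s)` is measurable and bounded, `Σ_{s′ : init s′ = s} χ_{k+1}(s′)(V′)·slotT_{k+1}(s′)(V′) = T_k(χ_k(s)·slot_k(s))(V′)` at EVERY coarse field `V′` (def-T `tstepOfRecord_apply`;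
Bochner linearity on the probability averaging kernel; K0b's pointwise law `Σ_{s′ : init s′ = s} χ_{k+1}(s′)(V′)·w(s′)(U,V′) = 1`).  Generalises K0b's level-1 identity.
[cite: Balaban1988Convergent, (3.1) p.264, §3 p.267 («we represent this sum as a sum over admissible domains»), (3.24)–(3.25) p.270] -/
theorem sum_fiber_chi_mul_slotsT_succ_eq_transport {ζ : ZetaOfRecord F N ν τ.M} (hζ : IsZetaUnity F N ν τ.M ζ) (hζ' : IsZetaAbsLeOne F N ν τ.M ζ)
    (E : B12.RunParams → ℝ) (ppSel : PpSelOfRecord F ν τ.M) (p : B12.RunParams) (g : ℕ → ℝ) (k : ℕ)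
    (hw : ∀ (s' : SeqOfRecord F ν τ.M g p.K (k + 1)) (V' : GaugeField (F.P p.K) (k + 1) (SU N)),
      Measurable (fun U : GaugeField (F.P p.K) k (SU N) => wOfRecord F N ν τ.M A₁ ζ p g k s' U V'))
    (s : SeqOfRecord F ν τ.M g p.K k) {B : ℝ}
    (hmeas : Measurable (fun U => chiSeqOfRecord F N ν τ.M g p.K k s U * slotsOfRecord F N ν τ E (wOfRecord F N ν τ.M A₁ ζ) ppSel p g k s U))
    (hB : ∀ U, |chiSeqOfRecord F N ν τ.M g p.K k s U * slotsOfRecord F N ν τ E (wOfRecord F N ν τ.M A₁ ζ) ppSel p g k s U| ≤ B)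
    (V' : GaugeField (F.P p.K) (k + 1) (SU N)) :
    ∑ s' ∈ Finset.univ.filter (fun s' : SeqOfRecord F ν τ.M g p.K (k + 1) => s'.init = s),
        chiSeqOfRecord F N ν τ.M g p.K (k + 1) s' V' * slotsTOfRecord F N ν τ E (wOfRecord F N ν τ.M A₁ ζ) ppSel p g (k + 1) s' V'
      = transportOfRecord F N p.K k
          (fun U => chiSeqOfRecord F N ν τ.M g p.K k s U * slotsOfRecord F N ν τ E (wOfRecord F N ν τ.M A₁ ζ) ppSel p g k s U) V' := by
  set w := wOfRecord F N ν τ.M A₁ ζ with hwdef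
  set term : GaugeField (F.P p.K) k (SU N) → ℝ :=
    fun U => chiSeqOfRecord F N ν τ.M g p.K k s U * slotsOfRecord F N ν τ E w ppSel p g k s U with hterm
  set κ := avgKernel (avOfRecord F N p.K k).avg V' with hκ
  set h : ℝ := (avgDensity (avOfRecord F N p.K k).avg V' : ℝ) with hh
  set fib := Finset.univ.filter (fun s' : SeqOfRecord F ν τ.M g p.K (k + 1) => s'.init = s) with hfib
  -- the T-step slot at `s'` with `init s' = s`, unfolded on the averaging kernel
  have hslot : ∀ s' ∈ fib, slotsTOfRecord F N ν τ E w ppSel p g (k + 1) s' V' = h * ∫ U, w p g k s' U V' * term U ∂κ := by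
    intro s' hs'
    have hs : s'.init = s := (Finset.mem_filter.1 hs').2
    show transportOfRecord F N p.K k (fun U => w p g k s' U V' *
      (chiSeqOfRecord F N ν τ.M g p.K k s'.init U * slotsOfRecord F N ν τ E w ppSel p g k s'.init U)) V' = _
    rw [hs]
    rfl
  have hrhs : transportOfRecord F N p.K k term V' = h * ∫ U, term U ∂κ := rfl
  -- each piece is integrable against the probability kernel (bounded and measurable)
  have hint : ∀ s' ∈ fib, Integrable (fun U => chiSeqOfRecord F N ν τ.M g p.K (k + 1) s' V' * (w p g k s' U V' * term U)) κ := by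
    intro s' _
    have hm : Measurable (fun U => chiSeqOfRecord F N ν τ.M g p.K (k + 1) s' V' * (w p g k s' U V' * term U)) :=
      measurable_const.mul ((hw s' V').mul hmeas)
    refine Integrable.of_bound hm.aestronglyMeasurable B (Filter.Eventually.of_forall fun U => ?_)
    rw [Real.norm_eq_abs, abs_mul, abs_mul]
    have h1 : |chiSeqOfRecord F N ν τ.M g p.K (k + 1) s' V'| ≤ 1 := abs_chiSeqOfRecord_le_one F N ν τ.M g p.K (k + 1) s' V'
    have h2 : |w p g k s' U V'| ≤ 1 := abs_wOfRecord_le_one F N ν τ.M A₁ hζ' p g k s' U V'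
    have hB0 : 0 ≤ B := (abs_nonneg _).trans (hB U)
    calc |chiSeqOfRecord F N ν τ.M g p.K (k + 1) s' V'| * (|w p g k s' U V'| * |term U|) ≤ 1 * (1 * B) := by
          gcongr
          exact hB U
      _ = B := by ring
  rw [hrhs]
  calc ∑ s' ∈ fib, chiSeqOfRecord F N ν τ.M g p.K (k + 1) s' V' * slotsTOfRecord F N ν τ E w ppSel p g (k + 1) s' V'
      = ∑ s' ∈ fib, h * ∫ U, chiSeqOfRecord F N ν τ.M g p.K (k + 1) s' V' * (w p g k s' U V' * term U) ∂κ := by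
        refine Finset.sum_congr rfl fun s' hs' => ?_
        rw [hslot s' hs', integral_const_mul]
        ring
    _ = h * ∫ U, ∑ s' ∈ fib, chiSeqOfRecord F N ν τ.M g p.K (k + 1) s' V' * (w p g k s' U V' * term U) ∂κ := by
        rw [integral_finsetSum _ hint, Finset.mul_sum]
    _ = h * ∫ U, term U ∂κ := by
        congr 1
        refine integral_congr_ae (Filter.Eventually.of_forall fun U => ?_)
        have hsum := sum_chi_mul_wOfRecord_eq_one F N ν τ.M A₁ hζ p g k s U V'
        calc ∑ s' ∈ fib, chiSeqOfRecord F N ν τ.M g p.K (k + 1) s' V' * (w p g k s' U V' * term U)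
            = (∑ s' ∈ fib, chiSeqOfRecord F N ν τ.M g p.K (k + 1) s' V' * w p g k s' U V') * term U := by
              rw [Finset.sum_mul]
              exact Finset.sum_congr rfl fun s' _ => by ring
          _ = term U := by rw [hsum, one_mul]

open Classical in
/-- **★★ `𝐓ρ_k = T_k(ρ_k)` POINTWISE, AT EVERY LEVEL**: for def-T's weights with the two ζ-laws and measurable `U`-sections, if every level-`k` history term is measurable and bounded, the
𝐓-stepped density of record `𝐓ρ_k = Σ_{s′} χ_{k+1}(s′)·slotT_{k+1}(s′)` (def-T `trhoOfRecord9`) IS the one-step kernel transport of the density of record `ρ_k = Σ_s χ_k(s)·slot_k(s)` at EVERY coarse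
field (`Seq.sum` split along `init` + ★ above + linearity of the transport over the old histories).  The (2.18) bookkeeping commutes with (3.1).
[cite: Balaban1988Convergent, (2.18) p.257, (3.1) p.264, (3.25) p.270] -/
theorem trhoOfRecord9_eq_transport_rho {ζ : ZetaOfRecord F N ν τ.M} (hζ : IsZetaUnity F N ν τ.M ζ) (hζ' : IsZetaAbsLeOne F N ν τ.M ζ)
    (E : B12.RunParams → ℝ) (ppSel : PpSelOfRecord F ν τ.M) (p : B12.RunParams) (g : ℕ → ℝ) (k : ℕ)
    (hw : ∀ (s' : SeqOfRecord F ν τ.M g p.K (k + 1)) (V' : GaugeField (F.P p.K) (k + 1) (SU N)),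
      Measurable (fun U : GaugeField (F.P p.K) k (SU N) => wOfRecord F N ν τ.M A₁ ζ p g k s' U V'))
    {B : ℝ}
    (hmeas : ∀ s, Measurable (fun U => chiSeqOfRecord F N ν τ.M g p.K k s U * slotsOfRecord F N ν τ E (wOfRecord F N ν τ.M A₁ ζ) ppSel p g k s U))
    (hB : ∀ s U, |chiSeqOfRecord F N ν τ.M g p.K k s U * slotsOfRecord F N ν τ E (wOfRecord F N ν τ.M A₁ ζ) ppSel p g k s U| ≤ B)
    (V' : GaugeField (F.P p.K) (k + 1) (SU N)) :
    trhoOfRecord9 F N ν τ E (wOfRecord F N ν τ.M A₁ ζ) ppSel p g k V'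
      = transportOfRecord F N p.K k (rhoOfRecord9 F N ν τ E (wOfRecord F N ν τ.M A₁ ζ) ppSel p g k) V' := by
  set w := wOfRecord F N ν τ.M A₁ ζ with hwdef
  -- integrability of each old term against the probability kernel at `V'`
  have hint : ∀ s ∈ (Finset.univ : Finset (SeqOfRecord F ν τ.M g p.K k)),
      Integrable (fun U => chiSeqOfRecord F N ν τ.M g p.K k s U * slotsOfRecord F N ν τ E w ppSel p g k s U) (avgKernel (avOfRecord F N p.K k).avg V') := by
    intro s _
    exact Integrable.of_bound (hmeas s).aestronglyMeasurable B (Filter.Eventually.of_forall fun U => by rw [Real.norm_eq_abs]; exact hB s U)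
  have hlhs : trhoOfRecord9 F N ν τ E w ppSel p g k V' =
      ∑ s' : SeqOfRecord F ν τ.M g p.K (k + 1), chiSeqOfRecord F N ν τ.M g p.K (k + 1) s' V' * slotsTOfRecord F N ν τ E w ppSel p g (k + 1) s' V' := rfl
  have hrho : rhoOfRecord9 F N ν τ E w ppSel p g k =
      fun U => ∑ s : SeqOfRecord F ν τ.M g p.K k, chiSeqOfRecord F N ν τ.M g p.K k s U * slotsOfRecord F N ν τ E w ppSel p g k s U := rfl
  rw [hlhs, Seq.sum_seq_succ_fiber, hrho]
  -- linearity of the transport over the old histories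
  have hlin : transportOfRecord F N p.K k
        (fun U => ∑ s : SeqOfRecord F ν τ.M g p.K k, chiSeqOfRecord F N ν τ.M g p.K k s U * slotsOfRecord F N ν τ E w ppSel p g k s U) V'
      = ∑ s : SeqOfRecord F ν τ.M g p.K k,
          transportOfRecord F N p.K k (fun U => chiSeqOfRecord F N ν τ.M g p.K k s U * slotsOfRecord F N ν τ E w ppSel p g k s U) V' := by
    show kernelTransport _ _ _ _ V' = ∑ s, kernelTransport _ _ _ _ V'
    simp only [kernelTransport]
    rw [integral_finsetSum _ hint, Finset.mul_sum]
  rw [hlin]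
  exact Finset.sum_congr rfl fun s _ =>
    sum_fiber_chi_mul_slotsT_succ_eq_transport F N ν τ A₁ hζ hζ' E ppSel p g k hw s (hmeas s) (hB s) V'

end Generic

/-! ## §2. AT K1⁷'s RECORD: `𝐓ρ_k = T_k(ρ_k)`; at a live selector `ρ_{k+1} ≤ T_k(ρ_k)` and the SHARP sup road `ρ_k ≤ e^{−E(P)}·Π_{j<k} D_j` (no history count) -/

section AtRecord

variable (F : T4Family) (N : ℕ) [NeZero N]
variable (θ : Stage13HParams F N) (P : B12.RunParams)

/-- **★★ `𝐓ρ_k = T_k(ρ_k)` POINTWISE AT THE STAGE-13 RECORD** (`tdensOfRecord₁₃`, `densOfRecord₁₃`): under `Provisos₁₃CoPH` (ζ-laws; def-T's `measW` sections) and the displayed row «every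
level-`k` history term `χ_k(s)·slot_k(s)` is measurable (K0c under (H-U)) and bounded by `B`», for `k < K`, the 𝐓-stepped density of record IS def-T's kernel transport of the density of
record at every coarse field.  Nothing of Bałaban's asserted. [cite: Balaban1988Convergent, (2.18) p.257, (3.1) p.264, (3.25) p.270] -/
theorem tdensOfRecord₁₃_eq_transport_dens (h : θ.Provisos₁₃CoPH F N) (k : ℕ) (hk : k < P.K) {B : ℝ}
    (hmeas : ∀ s : SeqOfRecord F θ.ν θ.τ9.M (gOfRecord₁₃ F N θ.toStage13Params P) P.K k,
      Measurable (fun U => chiSeqOfRecord F N θ.ν θ.τ9.M (gOfRecord₁₃ F N θ.toStage13Params P) P.K k s U *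
        slotsOfRecord F N θ.ν θ.τ9 (EOfRecord₁₃ F N θ.toStage13Params) (wOfRecord₉ F N θ.toStage9Params) θ.ppSel P (gOfRecord₁₃ F N θ.toStage13Params P) k s U))
    (hB : ∀ (s : SeqOfRecord F θ.ν θ.τ9.M (gOfRecord₁₃ F N θ.toStage13Params P) P.K k) U,
      |chiSeqOfRecord F N θ.ν θ.τ9.M (gOfRecord₁₃ F N θ.toStage13Params P) P.K k s U *
        slotsOfRecord F N θ.ν θ.τ9 (EOfRecord₁₃ F N θ.toStage13Params) (wOfRecord₉ F N θ.toStage9Params) θ.ppSel P (gOfRecord₁₃ F N θ.toStage13Params P) k s U| ≤ B) :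
    ∀ V' : GaugeField (F.P P.K) (k + 1) (SU N),
      tdensOfRecord₁₃ F N θ.toStage13Params P k V' = transportOfRecord F N P.K k (densOfRecord₁₃ F N θ.toStage13Params P k) V' := by
  intro V'
  have hw : ∀ (s' : SeqOfRecord F θ.ν θ.τ9.M (gOfRecord₁₃ F N θ.toStage13Params P) P.K (k + 1)) (V' : GaugeField (F.P P.K) (k + 1) (SU N)),
      Measurable (fun U : GaugeField (F.P P.K) k (SU N) => wOfRecord₉ F N θ.toStage9Params P (gOfRecord₁₃ F N θ.toStage13Params P) k s' U V') :=
    fun s' V'' => Measurable.of_uncurry_left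
      (f := fun (W : GaugeField (F.P P.K) (k + 1) (SU N)) (U : GaugeField (F.P P.K) k (SU N)) =>
        wOfRecord₉ F N θ.toStage9Params P (gOfRecord₁₃ F N θ.toStage13Params P) k s' U W) ((h.tstep P k hk).measW s')
  exact trhoOfRecord9_eq_transport_rho F N θ.ν θ.τ9 θ.A₁ h.zetaUnity h.zetaAbs (EOfRecord₁₃ F N θ.toStage13Params) θ.ppSel P
    (gOfRecord₁₃ F N θ.toStage13Params P) k hw hmeas hB V'

/-- **★★ `ρ_{k+1}(V′) ≤ T_k(ρ_k)(V′)` AT EVERY FIELD, at a live-selector parameter** (dag-n13-w1 g4's `ρ_{k+1} ≤ 𝐓ρ_k` p607786 ∘ `𝐓ρ_k = T_k(ρ_k)` above): the post-𝐑 density after one more step is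
dominated pointwise by def-T's kernel transport of the previous density — the 𝐑-step and the whole (2.18) index are gone; what remains of the (U1) leaf at these parameters is an
everywhere bound on `T_k(ρ_k)`.  Row: measurable bounded level-`k` terms.  Nothing of Bałaban's asserted. [cite: Balaban1989LargeFieldI, (0.2)–(0.3) p.176, p.177 (i)–(ii); Balaban1988Convergent, (3.1) p.264] -/
theorem densOfRecord₁₃_succ_le_transport_dens_of_liveSel (h : θ.Provisos₁₃CoPH F N)
    (hsel : θ.toStage13Params.ppSel = ppSelLiveOfRecord F N θ.ν θ.τ9 (EOfRecord₁₃ F N θ.toStage13Params) (wOfRecord₉ F N θ.toStage9Params))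
    (k : ℕ) (hk : k < P.K) {B : ℝ}
    (hmeas : ∀ s : SeqOfRecord F θ.ν θ.τ9.M (gOfRecord₁₃ F N θ.toStage13Params P) P.K k,
      Measurable (fun U => chiSeqOfRecord F N θ.ν θ.τ9.M (gOfRecord₁₃ F N θ.toStage13Params P) P.K k s U *
        slotsOfRecord F N θ.ν θ.τ9 (EOfRecord₁₃ F N θ.toStage13Params) (wOfRecord₉ F N θ.toStage9Params) θ.ppSel P (gOfRecord₁₃ F N θ.toStage13Params P) k s U))
    (hB : ∀ (s : SeqOfRecord F θ.ν θ.τ9.M (gOfRecord₁₃ F N θ.toStage13Params P) P.K k) U,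
      |chiSeqOfRecord F N θ.ν θ.τ9.M (gOfRecord₁₃ F N θ.toStage13Params P) P.K k s U *
        slotsOfRecord F N θ.ν θ.τ9 (EOfRecord₁₃ F N θ.toStage13Params) (wOfRecord₉ F N θ.toStage9Params) θ.ppSel P (gOfRecord₁₃ F N θ.toStage13Params P) k s U| ≤ B) :
    ∀ V' : GaugeField (F.P P.K) (k + 1) (SU N),
      densOfRecord₁₃ F N θ.toStage13Params P (k + 1) V' ≤ transportOfRecord F N P.K k (densOfRecord₁₃ F N θ.toStage13Params P k) V' := fun V' =>
  (densOfRecord₁₃_succ_le_tdens_of_liveSel θ.toStage13Params h.zetaUnity h.zetaAbs hsel P k V').trans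
    (tdensOfRecord₁₃_eq_transport_dens F N θ P h k hk hmeas hB V').le

/-- The history terms of record are `≥ 0` under the ζ-laws (`χ ≥ 0`; slots `≥ 0` by K0's `slotsOfRecord_nonneg` at `wOfRecord₉ ≥ 0`). [cite: Balaban1988Convergent, (2.18) p.257 (bookkeeping)] -/
theorem histTerm₁₃_nonneg (h : θ.Provisos₁₃CoPH F N) (k : ℕ)
    (s : SeqOfRecord F θ.ν θ.τ9.M (gOfRecord₁₃ F N θ.toStage13Params P) P.K k) (U : GaugeField (F.P P.K) k (SU N)) :
    0 ≤ chiSeqOfRecord F N θ.ν θ.τ9.M (gOfRecord₁₃ F N θ.toStage13Params P) P.K k s U *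
        slotsOfRecord F N θ.ν θ.τ9 (EOfRecord₁₃ F N θ.toStage13Params) (wOfRecord₉ F N θ.toStage9Params) θ.ppSel P (gOfRecord₁₃ F N θ.toStage13Params P) k s U :=
  mul_nonneg (chiSeqOfRecord_nonneg F N θ.ν θ.τ9.M _ P.K k s U)
    (slotsOfRecord_nonneg F N θ.ν θ.τ9 (EOfRecord₁₃ F N θ.toStage13Params) (wOfRecord₉_nonneg θ.toStage13Params h.zetaUnity h.zetaAbs) θ.ppSel P _ k s U)

/-- A bound on the density bounds every history term (the terms are `≥ 0` and sum to the density). [cite: Balaban1988Convergent, (2.18) p.257 (bookkeeping)] -/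
theorem abs_histTerm₁₃_le_of_dens_le (h : θ.Provisos₁₃CoPH F N) (k : ℕ) {B : ℝ}
    (hρ : ∀ U, densOfRecord₁₃ F N θ.toStage13Params P k U ≤ B)
    (s : SeqOfRecord F θ.ν θ.τ9.M (gOfRecord₁₃ F N θ.toStage13Params P) P.K k) (U : GaugeField (F.P P.K) k (SU N)) :
    |chiSeqOfRecord F N θ.ν θ.τ9.M (gOfRecord₁₃ F N θ.toStage13Params P) P.K k s U *
        slotsOfRecord F N θ.ν θ.τ9 (EOfRecord₁₃ F N θ.toStage13Params) (wOfRecord₉ F N θ.toStage9Params) θ.ppSel P (gOfRecord₁₃ F N θ.toStage13Params P) k s U| ≤ B := by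
  classical
  rw [abs_of_nonneg (histTerm₁₃_nonneg F N θ P h k s U)]
  refine le_trans ?_ (hρ U)
  show _ ≤ ∑ t : SeqOfRecord F θ.ν θ.τ9.M (gOfRecord₁₃ F N θ.toStage13Params P) P.K k, _
  exact Finset.single_le_sum (fun t _ => histTerm₁₃_nonneg F N θ P h k t U) (Finset.mem_univ s)

/-- **★★ THE DENSITY-LEVEL SUP STEP** (live selector): if `ρ_k ≤ B` everywhere (`B`: any bound) and the level-`k` terms are measurable, then `ρ_{k+1}(V′) ≤ B · avgDensity_k(V′)` at every field —
p607601's domination `T_k f ≤ sup f · avgDensity_k` after `ρ_{k+1} ≤ T_k(ρ_k)`; NO history count (unity collapsed it).  Nothing of Bałaban's asserted.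
[cite: Balaban1988Convergent, (3.1) p.264; Balaban1989LargeFieldI, (0.2)–(0.3) p.176] -/
theorem densOfRecord₁₃_succ_le_mul_avgDensity_of_liveSel (h : θ.Provisos₁₃CoPH F N)
    (hsel : θ.toStage13Params.ppSel = ppSelLiveOfRecord F N θ.ν θ.τ9 (EOfRecord₁₃ F N θ.toStage13Params) (wOfRecord₉ F N θ.toStage9Params))
    (k : ℕ) (hk : k < P.K) {B : ℝ}
    (hmeas : ∀ s : SeqOfRecord F θ.ν θ.τ9.M (gOfRecord₁₃ F N θ.toStage13Params P) P.K k,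
      Measurable (fun U => chiSeqOfRecord F N θ.ν θ.τ9.M (gOfRecord₁₃ F N θ.toStage13Params P) P.K k s U *
        slotsOfRecord F N θ.ν θ.τ9 (EOfRecord₁₃ F N θ.toStage13Params) (wOfRecord₉ F N θ.toStage9Params) θ.ppSel P (gOfRecord₁₃ F N θ.toStage13Params P) k s U))
    (hρ : ∀ U, densOfRecord₁₃ F N θ.toStage13Params P k U ≤ B) :
    ∀ V' : GaugeField (F.P P.K) (k + 1) (SU N),
      densOfRecord₁₃ F N θ.toStage13Params P (k + 1) V' ≤ B * (avgDensity (avOfRecord F N P.K k).avg V' : ℝ) := by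
  classical
  intro V'
  have hB := abs_histTerm₁₃_le_of_dens_le F N θ P h k hρ
  refine (densOfRecord₁₃_succ_le_transport_dens_of_liveSel F N θ P h hsel k hk hmeas hB V').trans ?_
  -- `T_k(ρ_k) ≤ B · T_k(1) = B · avgDensity_k` (domination with the constant majorant; `ρ_k` measurable as a finite sum of measurable terms)
  have hρm : Measurable (densOfRecord₁₃ F N θ.toStage13Params P k) := by
    have : densOfRecord₁₃ F N θ.toStage13Params P k = fun U => ∑ s : SeqOfRecord F θ.ν θ.τ9.M (gOfRecord₁₃ F N θ.toStage13Params P) P.K k,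
        chiSeqOfRecord F N θ.ν θ.τ9.M (gOfRecord₁₃ F N θ.toStage13Params P) P.K k s U *
          slotsOfRecord F N θ.ν θ.τ9 (EOfRecord₁₃ F N θ.toStage13Params) (wOfRecord₉ F N θ.toStage9Params) θ.ppSel P (gOfRecord₁₃ F N θ.toStage13Params P) k s U := rfl
    rw [this]
    exact Finset.measurable_sum _ fun s _ => hmeas s
  have hρ0 : ∀ U, 0 ≤ densOfRecord₁₃ F N θ.toStage13Params P k U := fun U =>
    Finset.sum_nonneg fun s _ => histTerm₁₃_nonneg F N θ P h k s U
  have hdom := abs_transportOfRecord_le F N P.K k (h := densOfRecord₁₃ F N θ.toStage13Params P k) (H := fun _ => B)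
    (fun U => by rw [abs_of_nonneg (hρ0 U)]; exact hρ U) measurable_const (C := B) (fun _ => le_rfl) V'
  refine (le_abs_self _).trans (hdom.trans (le_of_eq ?_))
  have hc := transportOfRecord_const_mul F N P.K k B (fun _ => (1 : ℝ)) V'
  simp only [mul_one] at hc
  rw [hc]
  simp only [transportOfRecord, transportK, kernelTransport, integral_const, smul_eq_mul, probReal_univ, one_mul]
  ring

/-- **★★★ THE SHARP SUP ROAD** (live selector, ζ-laws): from EVERYWHERE bounds `avgDensity_j(V′) ≤ D_j` (`j < k`) on the marginal-density VERSIONS of def-T's one-step transports (dag-n13-w1 g4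
§5's located object; the tree knows them `dV′`-a.e. only) and the measurability row on the history terms at the levels `< k`, `ρ_k(V) ≤ e^{−E(P)} · Π_{j<k} D_j` AT EVERY FIELD — NO history
count (unity), NO small factor.  LOCATED READING: `−E(P) = −Σ_{j<K} e_j` (def-R `EOfRecord`; `e_j` extensive at scale `j`, `tstarCount_j ≈ L^{4(k−j)}|T₁^{(k)}|`) against (2.50)'s `E₊|T₁^{(k)}|`:
print cancels the `e_j` inside the fibre integrals ((1.15), (2.23)'s `E^{(j)}`, (3.10)–(3.25), (2.49)); `T_k(ρ_k) ≤ sup ρ_k · avgDensity_k` forgets the fibre AVERAGE — a theorem WITHOUT value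
for (2.50); the (U1) content at a live selector is a bound on `T_k(ρ_k)` finer than `sup ρ_k` (field-dependent currency, p607601 §2).  Nothing of Bałaban's asserted.
[cite: Balaban1988Convergent, (1.15) p.249, Thm 1 p.262, (2.49) + Cor. 3 (2.50) p.264; Balaban1989LargeFieldI, (0.2)–(0.3) p.176; Balaban1989LargeFieldII, (0.1) pp.355–356] -/
theorem densOfRecord₁₃_le_exp_mul_prod_of_avgDensity_le_of_liveSel (h : θ.Provisos₁₃CoPH F N)
    (hsel : θ.toStage13Params.ppSel = ppSelLiveOfRecord F N θ.ν θ.τ9 (EOfRecord₁₃ F N θ.toStage13Params) (wOfRecord₉ F N θ.toStage9Params))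
    (k : ℕ) (hk : k ≤ P.K) (D : ℕ → ℝ)
    (hD : ∀ j, j < k → ∀ V' : GaugeField (F.P P.K) (j + 1) (SU N), (avgDensity (avOfRecord F N P.K j).avg V' : ℝ) ≤ D j)
    (hmeas : ∀ j, j < k → ∀ s : SeqOfRecord F θ.ν θ.τ9.M (gOfRecord₁₃ F N θ.toStage13Params P) P.K j,
      Measurable (fun U => chiSeqOfRecord F N θ.ν θ.τ9.M (gOfRecord₁₃ F N θ.toStage13Params P) P.K j s U *
        slotsOfRecord F N θ.ν θ.τ9 (EOfRecord₁₃ F N θ.toStage13Params) (wOfRecord₉ F N θ.toStage9Params) θ.ppSel P (gOfRecord₁₃ F N θ.toStage13Params P) j s U)) :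
    ∀ V : GaugeField (F.P P.K) k (SU N),
      densOfRecord₁₃ F N θ.toStage13Params P k V ≤ Real.exp (-EOfRecord₁₃ F N θ.toStage13Params P) * ∏ j ∈ Finset.range k, D j := by
  induction k with
  | zero =>
    intro V
    rw [densOfRecord₁₃_zero, Finset.range_zero, Finset.prod_empty, mul_one]
    exact rhoZeroOfRecord_le F N P.K _ _ V
  | succ k ih =>
    intro V'
    have hkK : k < P.K := Nat.lt_of_succ_le hk
    have ih' := ih hkK.le (fun j hj => hD j (Nat.lt_succ_of_lt hj)) (fun j hj => hmeas j (Nat.lt_succ_of_lt hj))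
    have hstep := densOfRecord₁₃_succ_le_mul_avgDensity_of_liveSel F N θ P h hsel k hkK (hmeas k (Nat.lt_succ_self k)) ih' V'
    have hB0 : 0 ≤ Real.exp (-EOfRecord₁₃ F N θ.toStage13Params P) * ∏ j ∈ Finset.range k, D j := by
      refine mul_nonneg (Real.exp_pos _).le (Finset.prod_nonneg fun j hj => ?_)
      have W : GaugeField (F.P P.K) (j + 1) (SU N) := fun _ => 1
      exact (NNReal.coe_nonneg _).trans (hD j (Nat.lt_succ_of_lt (Finset.mem_range.1 hj)) W)
    calc densOfRecord₁₃ F N θ.toStage13Params P (k + 1) V'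
        ≤ (Real.exp (-EOfRecord₁₃ F N θ.toStage13Params P) * ∏ j ∈ Finset.range k, D j) * (avgDensity (avOfRecord F N P.K k).avg V' : ℝ) := hstep
      _ ≤ (Real.exp (-EOfRecord₁₃ F N θ.toStage13Params P) * ∏ j ∈ Finset.range k, D j) * D k :=
          mul_le_mul_of_nonneg_left (hD k (Nat.lt_succ_self k) V') hB0
      _ = Real.exp (-EOfRecord₁₃ F N θ.toStage13Params P) * ∏ j ∈ Finset.range (k + 1), D j := by
          rw [Finset.prod_range_succ]; ring

end AtRecord

end Summit.QuantumFields.YangMills.BalabanUVNodes.N13TStepDensityIsTransportAtRecord13CoPH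

end
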